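import Mathlib
import HarnessLib
import Literature.Computability.AlgebraicComplexity.StandardFamilies
import Literature.Computability.Complexity.SymmetricCircuit
import Literature.Computability.Complexity.CircuitSemantics
import Literature.Computability.Complexity.ConstantDepth

/-!
# SymmetryDial — first rung of the affine CFI obstruction (`AffineCFIPairs` at budget `0`)

Decomposition workshop decomp-valiant, cycle 1 (VALIANT), lens 1, generation 5.  LADDER-Valiant rung 0:
nothing here proves VP ≠ VNP.

`Theorems/SymmetryDialAffineCFISplit.lean` splits supported affine-symmetric hardness (A₂,
`SymHardAffineSupported`) as `AffineCFIPairs ∧ AffineThresholdTranslation`.  This file PROVES the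
budget-`0` instance of the obstruction `AffineCFIPairs`, in dimension `d = 2`, in a slightly stronger
form (no simple-wiring hypothesis):

there are two `0/1` matrices `A, B` on `𝔽₂² × 𝔽₂²` with DIFFERENT `0/1`-permanents (`1` and `0`) on
which every Boolean circuit over the threshold basis that is symmetric under the diagonal action of
AGL₂(𝔽₂) and all of whose gates are `0`-supported (every affine map has an automorphism extension
fixing the gate) takes the same value.

Mechanism (the budget-`0` case of the «supports ⇒ game» direction): a `0`-supported gate reads its
input wires through a multiset of matrix positions invariant under the diagonal translations
(`countP_inTrue_comp_eq`); `A` is the permutation matrix of the shear `(v₀,v₁) ↦ (v₀+v₁, v₁)` and `B`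
is obtained from `A` by translating the two entries of `A` off the `𝔽₂ × 0` block by `(0,1)`, which
keeps every translation class count but empties a column; so every gate sees the same number of ones
under `A` and `B` (induction along the program, symmetric gates), while `per A = 1 ≠ 0 = per B`.
-/

set_option linter.dupNamespace false

namespace Summit.ValiantsHypothesis.ValiantsHypothesis.Theorems.SymmetryDialAffineCFIRung

open Literature.Computability.AlgebraicComplexity
open Literature.Computability.Complexity

/-! ### Generic: input counts of a gate fixed by an automorphism -/

section Generic

variable {ι : Type*}

/-- The truth value an input assignment gives to a wire, gate wires counting `false`. -/
def inTrue (x : ι → Bool) : ι ⊕ ℕ → Bool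
  | .inl i => x i
  | .inr _ => false

/-- The truth value a list of gate values gives to a wire, input wires counting `false`. -/
def gateTrue (vals : List Bool) : ι ⊕ ℕ → Bool
  | .inl _ => false
  | .inr m => vals.getD m false

omit ι in
/-- Counting a disjoint disjunction. -/
theorem countP_or_of_disjoint {α : Type*} (p q : α → Bool) (l : List α)
    (h : ∀ a, ¬ (p a = true ∧ q a = true)) :
    l.countP (fun a => p a || q a) = l.countP p + l.countP q := by
  induction l with
  | nil => simp
  | cons a l ih =>
    simp only [List.countP_cons, ih]
    have ha := h a
    cases hp : p a <;> cases hq : q a <;> simp_all <;> omega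

/-- A wire value is an input value or a gate value. -/
theorem wireVal_eq_or (x : ι → Bool) (vals : List Bool) (w : ι ⊕ ℕ) :
    wireVal x vals w = (inTrue x w || gateTrue vals w) := by
  cases w <;> simp [wireVal, inTrue, gateTrue]

/-- **Input counts are invariant along a fixing automorphism.**  If `τ` is an induced automorphism of
`Ψ` extending `π` and fixing gate `j`, then the number of input wires of `j` made true by `x ∘ π`
equals the number made true by `x`. -/
theorem countP_inTrue_comp_eq (Ψ : Circuit ι) {π : ι → ι} {τ : Equiv.Perm (Fin Ψ.gates.length)}
    (h : Ψ.IsInducedAut π τ) (j : Fin Ψ.gates.length) (hj : τ j = j) (x : ι → Bool) :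
    (List.ofFn (Ψ.gates[j]).args).countP (inTrue fun i => x (π i)) =
      (List.ofFn (Ψ.gates[j]).args).countP (inTrue x) := by
  have hperm := (h.2 j).2
  have e : Ψ.gates[τ j] = Ψ.gates[j] := congrArg (fun i : Fin Ψ.gates.length => Ψ.gates[i]) hj
  rw [e] at hperm
  rw [hperm.countP_eq (inTrue x), List.countP_map]
  refine List.countP_congr fun w _ => ?_
  cases w with
  | inl i => simp [inTrue, Circuit.relabelWire]
  | inr m => simp [inTrue, Circuit.relabelWire]

/-- **Equal input counts at every gate force equal transcripts** (symmetric gates). -/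
theorem transcript_getD_eq (Ψ : Circuit ι) (hB : Ψ.IsOver tcBasis) (x y : ι → Bool)
    (hin : ∀ j : Fin Ψ.gates.length,
      (List.ofFn (Ψ.gates[j]).args).countP (inTrue x) = (List.ofFn (Ψ.gates[j]).args).countP (inTrue y)) :
    ∀ (m : ℕ) (hm : m < Ψ.gates.length),
      (transcript x [] Ψ.gates).getD m false = (transcript y [] Ψ.gates).getD m false := by
  intro m
  induction m using Nat.strong_induction_on with
  | _ m ih =>
    intro hm
    rw [getD_transcript_eq_gateValue Ψ x m hm, getD_transcript_eq_gateValue Ψ y m hm, gateValue, gateValue]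
    refine Gate.op_eq_op_of_fn_eq rfl (isSymmetric_of_mem_tcBasis (hB _ (List.getElem_mem hm))) ?_
    rw [Circuit.numOnes_eq_countP_ofFn (wireVal x (transcript x [] Ψ.gates)),
      Circuit.numOnes_eq_countP_ofFn (wireVal y (transcript y [] Ψ.gates))]
    have hsplit : ∀ z : ι → Bool, (List.ofFn (Ψ.gates[m]).args).countP (fun w => wireVal z (transcript z [] Ψ.gates) w) =
        (List.ofFn (Ψ.gates[m]).args).countP (inTrue z) +
          (List.ofFn (Ψ.gates[m]).args).countP (gateTrue (transcript z [] Ψ.gates)) := by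
      intro z
      rw [← countP_or_of_disjoint]
      · exact List.countP_congr fun w _ => by rw [wireVal_eq_or]
      · intro w; cases w <;> simp [inTrue, gateTrue]
    have hinm := hin ⟨m, hm⟩
    simp only [Fin.getElem_fin] at hinm
    rw [hsplit x, hsplit y, hinm]
    congr 1
    refine List.countP_congr fun w hw => ?_
    obtain ⟨a, rfl⟩ := List.mem_ofFn.1 hw
    cases ha : (Ψ.gates[m]).args a with
    | inl i => rfl
    | inr k =>
      have hk : k < m := Ψ.wf m hm a k ha
      simp only [gateTrue]
      rw [ih k hk (hk.trans hm)]

end Generic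

/-! ### The dimension-2 witnesses -/

/-- `𝔽₂²`. -/
abbrev V2 : Type := Fin 2 → Fin 2

/-- The translation vector `b = (0,1)`. -/
def bvec : V2 := ![0, 1]

/-- First coordinate of `b`. -/
@[simp] theorem bvec_zero : bvec 0 = 0 := rfl
/-- Second coordinate of `b`. -/
@[simp] theorem bvec_one : bvec 1 = 1 := rfl

/-- Translation by `b`, as a permutation of `𝔽₂²`. -/
def tb : Equiv.Perm V2 := Equiv.addRight bvec

/-- Translation by `b` fixes the first coordinate. -/
@[simp] theorem tb_apply_zero (v : V2) : tb v 0 = v 0 := by simp [tb, Pi.add_apply]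
/-- Translation by `b` flips the second coordinate. -/
@[simp] theorem tb_apply_one (v : V2) : tb v 1 = v 1 + 1 := by simp [tb, Pi.add_apply]

/-- `𝔽₂²` has exponent `2`. -/
theorem two_self (c : V2) : c + c = 0 := by
  funext i
  have h : ∀ a : Fin 2, a + a = 0 := by decide
  exact h (c i)

/-- Translations preserve `x + y + z`, hence lie in (the closure generating) AGL₂(𝔽₂). -/
theorem tb_mem : tb ∈ Subgroup.closure
    {σ : Equiv.Perm (Fin 2 → Fin 2) | ∀ x y z : Fin 2 → Fin 2, σ (x + y + z) = σ x + σ y + σ z} := by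
  refine Subgroup.subset_closure fun x y z => ?_
  show x + y + z + bvec = x + bvec + (y + bvec) + (z + bvec)
  rw [show x + bvec + (y + bvec) + (z + bvec) = x + y + z + bvec + (bvec + bvec) by abel, two_self, add_zero]

/-- `A`: the permutation matrix of the shear `s(v) = (v₀ + v₁, v₁)`: `A(u,v) ⇔ v = s(u)` (equivalently
`u = s(v)`, `s` being an involution).  `per A = 1`. -/
def matA (p : V2 × V2) : Bool := decide (p.2 0 = p.1 0 + p.1 1 ∧ p.2 1 = p.1 1)

/-- `B`: all four positions inside the block `(𝔽₂ × 0) × (𝔽₂ × 0)`.  `per B = 0` (the column of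
`b = (0,1)` is empty). -/
def matB (p : V2 × V2) : Bool := decide (p.1 1 = 0 ∧ p.2 1 = 0)

/-- The part of `A` inside the block: the two fixed points of the shear. -/
def matA0 (p : V2 × V2) : Bool := matA p && decide (p.1 1 = 0)

/-- The part of `A` outside the block: the transposition `(0,1) ↔ (1,1)` of the shear. -/
def matA1 (p : V2 × V2) : Bool := matA p && decide (p.1 1 = 1)

/-- `A = A₀ ⊔ A₁`. -/
theorem matA_eq (p : V2 × V2) : matA p = (matA0 p || matA1 p) := by
  have key : ∀ a : Fin 2, ∀ t : Bool, t = (t && decide (a = 0) || t && decide (a = 1)) := by decide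
  exact key (p.1 1) (matA p)

/-- `A₀` and `A₁` are disjoint. -/
theorem matA_disjoint (p : V2 × V2) : ¬ (matA0 p = true ∧ matA1 p = true) := by
  have key : ∀ a : Fin 2, ∀ t : Bool, ¬ ((t && decide (a = 0)) = true ∧ (t && decide (a = 1)) = true) := by
    decide
  exact key (p.1 1) (matA p)

/-- `B = A₀ ⊔ t_b · A₁`: translating the off-block transposition by `b` lands it in the block. -/
theorem matB_eq (p : V2 × V2) : matB p = (matA0 p || matA1 (tb p.1, tb p.2)) := by
  have key : ∀ u0 u1 v0 v1 : Fin 2,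
      decide (u1 = 0 ∧ v1 = 0) =
        (decide (v0 = u0 + u1 ∧ v1 = u1) && decide (u1 = 0) ||
          (decide (v0 = u0 + (u1 + 1) ∧ v1 + 1 = u1 + 1) && decide (u1 + 1 = 1))) := by
    decide
  simpa [matB, matA0, matA1, matA] using key (p.1 0) (p.1 1) (p.2 0) (p.2 1)

/-- `A₀` and `t_b · A₁` are disjoint. -/
theorem matB_disjoint (p : V2 × V2) : ¬ (matA0 p = true ∧ matA1 (tb p.1, tb p.2) = true) := by
  have key : ∀ u0 u1 v0 v1 : Fin 2,
      ¬ ((decide (v0 = u0 + u1 ∧ v1 = u1) && decide (u1 = 0)) = true ∧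
          (decide (v0 = u0 + (u1 + 1) ∧ v1 + 1 = u1 + 1) && decide (u1 + 1 = 1)) = true) := by
    decide
  simpa [matA0, matA1, matA] using key (p.1 0) (p.1 1) (p.2 0) (p.2 1)

/-- **The counting heart.**  If the input multiset of a gate is invariant under the diagonal
translation by `b` (in the counting sense of `countP_inTrue_comp_eq`), it contains as many ones of `A`
as of `B`. -/
theorem countP_matA_eq_matB (L : List (V2 × V2 ⊕ ℕ))
    (hinv : ∀ x : V2 × V2 → Bool,
      L.countP (inTrue fun q => x (tb q.1, tb q.2)) = L.countP (inTrue x)) :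
    L.countP (inTrue matA) = L.countP (inTrue matB) := by
  have hA : L.countP (inTrue matA) = L.countP (inTrue matA0) + L.countP (inTrue matA1) := by
    rw [← countP_or_of_disjoint]
    · refine List.countP_congr fun w _ => ?_
      cases w with
      | inl p => simp [inTrue, matA_eq p]
      | inr m => simp [inTrue]
    · intro w; cases w with
      | inl p => simpa [inTrue] using matA_disjoint p
      | inr m => simp [inTrue]
  have hB : L.countP (inTrue matB) =
      L.countP (inTrue matA0) + L.countP (inTrue fun q => matA1 (tb q.1, tb q.2)) := by
    rw [← countP_or_of_disjoint]
    · refine List.countP_congr fun w _ => ?_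
      cases w with
      | inl p => simp [inTrue, matB_eq p]
      | inr m => simp [inTrue]
    · intro w; cases w with
      | inl p => simpa [inTrue] using matB_disjoint p
      | inr m => simp [inTrue]
  rw [hA, hB, hinv matA1]

/-! ### The `0/1`-permanents of the witnesses -/

/-- The `0/1`-permanent as a count of permutations inside the matrix. -/
theorem eval_perPoly_eq_card (x : V2 × V2 → Bool) :
    MvPolynomial.eval (fun ij => if x ij = true then (1 : ℂ) else 0) (perPoly V2 ℂ) =
      ((Finset.univ.filter fun σ : Equiv.Perm V2 => ∀ i, x (σ i, i) = true).card : ℂ) := by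
  simp only [perPoly, Matrix.permanent, map_sum, map_prod, Matrix.mvPolynomialX_apply,
    MvPolynomial.eval_X]
  rw [← Finset.sum_boole]
  refine Finset.sum_congr rfl fun σ _ => ?_
  exact Fintype.prod_boole

/-- The shear `s(v) = (v₀ + v₁, v₁)`, an involution of `𝔽₂²`. -/
def shearFun (v : V2) : V2 := ![v 0 + v 1, v 1]

/-- The shear is an involution. -/
theorem shearFun_invol (v : V2) : shearFun (shearFun v) = v := by
  have h : ∀ a c : Fin 2, a + c + c = a := by decide
  funext i
  fin_cases i
  · simp [shearFun, h]
  · simp [shearFun]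

/-- The shear as a permutation. -/
def shear : Equiv.Perm V2 := ⟨shearFun, shearFun, shearFun_invol, shearFun_invol⟩

/-- `per A ≠ 0`: the shear lies inside `A`. -/
theorem per_matA_ne_zero :
    (Finset.univ.filter fun σ : Equiv.Perm V2 => ∀ i, matA (σ i, i) = true).card ≠ 0 := by
  rw [Finset.card_ne_zero]
  refine ⟨shear, Finset.mem_filter.2 ⟨Finset.mem_univ _, fun i => ?_⟩⟩
  have h : ∀ a c : Fin 2, a = a + c + c := by decide
  simp [matA, shear, shearFun]
  exact h (i 0) (i 1)

/-- `per B = 0`: the column of `b` is empty. -/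
theorem per_matB_eq_zero :
    (Finset.univ.filter fun σ : Equiv.Perm V2 => ∀ i, matB (σ i, i) = true).card = 0 := by
  rw [Finset.card_eq_zero, Finset.filter_eq_empty_iff]
  intro σ _ h
  have hb := h bvec
  simp [matB] at hb

/-! ### The rung -/

/-- **`AffineCFIPairs` at budget `0` (dimension `2`), stronger form without the simple-wiring
hypothesis.**  The hypotheses on `Ψ` are verbatim `Circuit.IsOver tcBasis`, `BoolSymmetric Ψ` and
`∀ j, BoolSupported Ψ 0 j` of `Theorems/SymmetryDialAffineCFISplit.lean`, unfolded. -/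
theorem affineCFIPairs_rung_zero :
    ∃ A B : (Fin 2 → Fin 2) × (Fin 2 → Fin 2) → Bool,
      (∀ Ψ : Circuit ((Fin 2 → Fin 2) × (Fin 2 → Fin 2)),
        Ψ.IsOver tcBasis →
        (∀ σ : ↥(Subgroup.closure {σ : Equiv.Perm (Fin 2 → Fin 2) |
            ∀ x y z : Fin 2 → Fin 2, σ (x + y + z) = σ x + σ y + σ z}),
          ∃ τ : Equiv.Perm (Fin Ψ.gates.length), Ψ.IsInducedAut (fun q => (σ.1 q.1, σ.1 q.2)) τ) →
        (∀ j : Fin Ψ.gates.length, ∃ (U : Finset (Fin 2 → Fin 2)) (W : AddSubgroup (Fin 2 → Fin 2)),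
          U.card ≤ 0 ∧ W.index ≤ 2 ^ 0 ∧
          ∀ σ : ↥(Subgroup.closure {σ : Equiv.Perm (Fin 2 → Fin 2) |
              ∀ x y z : Fin 2 → Fin 2, σ (x + y + z) = σ x + σ y + σ z}),
            (∀ u ∈ U, σ.1 u = u) → (∀ v : Fin 2 → Fin 2, σ.1 v + v ∈ W) →
            ∃ τ : Equiv.Perm (Fin Ψ.gates.length),
              Ψ.IsInducedAut (fun q => (σ.1 q.1, σ.1 q.2)) τ ∧ τ j = j) →
        Ψ.eval A = Ψ.eval B) ∧
      MvPolynomial.eval (fun ij => if A ij = true then (1 : ℂ) else 0) (perPoly (Fin 2 → Fin 2) ℂ) ≠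
      MvPolynomial.eval (fun ij => if B ij = true then (1 : ℂ) else 0) (perPoly (Fin 2 → Fin 2) ℂ) := by
  refine ⟨matA, matB, fun Ψ hB hsym hsupp => ?_, ?_⟩
  · -- every gate is fixed by an automorphism extending the diagonal translation by `b`
    have hfix : ∀ j : Fin Ψ.gates.length, ∃ τ : Equiv.Perm (Fin Ψ.gates.length),
        Ψ.IsInducedAut (fun q => (tb q.1, tb q.2)) τ ∧ τ j = j := by
      intro j
      obtain ⟨U, W, hU, hW, h⟩ := hsupp j
      have hU0 : U = ∅ := Finset.card_eq_zero.1 (Nat.le_zero.1 hU)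
      have hW1 : W = ⊤ := by
        rw [← AddSubgroup.index_eq_one]
        have := AddSubgroup.index_ne_zero_of_finite (H := W)
        simp only [pow_zero] at hW
        omega
      exact h ⟨tb, tb_mem⟩ (by simp [hU0]) (by simp [hW1])
    -- hence input counts at every gate agree for `A` and `B`
    have hin : ∀ j : Fin Ψ.gates.length,
        (List.ofFn (Ψ.gates[j]).args).countP (inTrue matA) =
          (List.ofFn (Ψ.gates[j]).args).countP (inTrue matB) := by
      intro j
      obtain ⟨τ, hτ, hτj⟩ := hfix j
      exact countP_matA_eq_matB _ fun x => countP_inTrue_comp_eq Ψ hτ j hτj x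
    have htr := transcript_getD_eq Ψ hB matA matB hin
    -- the output wire is a gate (an input wire cannot be fixed by the translation)
    obtain ⟨τ, hτ⟩ := hsym ⟨tb, tb_mem⟩
    have hout := hτ.1
    rw [eval_eq_wireVal, eval_eq_wireVal]
    cases hC : Ψ.output with
    | inl p =>
      exfalso
      rw [hC, Circuit.relabelWire_inl, Sum.inl.injEq] at hout
      have h1 := congrFun (congrArg Prod.fst hout) 1
      simp [tb] at h1
    | inr m =>
      have hm : m < Ψ.gates.length := Ψ.wf_output m hC
      simp only [wireVal]
      exact htr m hm
  · rw [eval_perPoly_eq_card, eval_perPoly_eq_card, per_matB_eq_zero, Ne, Nat.cast_inj]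
    exact per_matA_ne_zero

end Summit.ValiantsHypothesis.ValiantsHypothesis.Theorems.SymmetryDialAffineCFIRung
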